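import Literature.AlgebraicGeometry.HodgeTheory.HodgeTypePullback
import Literature.AlgebraicGeometry.HodgeTheory.CupPreservesHodgeTypeOfDeRham
import Literature.AlgebraicGeometry.HodgeTheory.HodgeFiltrationModelsReductionProofs
import Literature.AlgebraicGeometry.HodgeTheory.ComplexConjugationHolds
import Literature.AlgebraicGeometry.HodgeTheory.WeilClassesFourfoldsProofs
import Literature.AlgebraicGeometry.Motives.AbelianVarietyProjectiveChart
import HarnessLib

/-!
# Pull-backs preserve Hodge types (closed form) and Hodge types of exterior products

Family `hodge`, layer `Literature/AlgebraicGeometry/HodgeTheory`. Theorems-only leaf companion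
(no definition, no named fact, D-0026) of `HodgeTypePullback` (Voisin I §7.3.2: `f^*` is a
morphism of Hodge structures, there proved as `preservesHodgeType_of_nonempty_hodgeModel` from the
two named facts `nonempty_hodgeModel`, `hodgePQ_independent_of_hodgeModel`), of
`CupPreservesHodgeTypeOfDeRham` (Voisin I Thm. 5.29 with §7.1.2: the cup product adds Hodge
types, `cupPreservesHodgeType_of_nonempty_hodgeModel` from the same two facts and de Rham's
theorem in its multiplicative form `Literature.NumberTheory.Transcendental.exists_deRhamIsoFamily`)
and of `WeilClassesFourfoldsProofs` (`isOfHodgeType_cupProduct_map_fst_map_snd`: Hodge types add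
under exterior products on a product of abelian varieties, relative to the layer's predicates
`PreservesHodgeType`, `CupPreservesHodgeType`).

Since those files were written, both model facts have been DISCHARGED in the tree:
`nonempty_hodgeModel_holds` (`ComplexConjugationHolds`: Serre's analytification, the natural
integration de Rham family of `DeRhamTheoremProofs`, the Hodge decomposition
`Motives.isInternal_hodgePQ_holds`) and `hodgePQ_independent_of_hodgeModel_holds`
(`HodgeFiltrationModelsReductionProofs`: rigidity of natural de Rham comparisons). Hence:

* `IsOfHodgeType.map_of_isSmoothProjective`, `preservesHodgeType_of_isSmoothProjective` —
  **pull-backs along morphisms of smooth projective complex varieties preserve Hodge types, with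
  NO hypothesis left** (Voisin I §7.3.2).
* `cupPreservesHodgeType_of_multiplicative_deRham` — `CupPreservesHodgeType n X` for every smooth
  projective `X` is ONE named fact away: the multiplicative de Rham theorem
  `exists_deRhamIsoFamily 𝓘(ℝ, E)` (Warner Thm. 5.45 "wedge ↦ cup" for the integration family,
  whose naturality and normalisation are theorems, `exists_isNatural_deRhamIsoFamily`), exactly as
  for `middleDimensionReduction_of_multiplicative_deRham`.
* `isOfHodgeType_cupProduct_map_map_of_cupPreservesHodgeType` — **Künneth compatibility of Hodge
  types** (Voisin I §11.3.2, Thm. 11.38: the exterior product `f^* c ⌣ g^* w` of a `(p, q)`-class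
  and a `(p', q')`-class is a `(p + p', q + q')`-class), for arbitrary morphisms `f : W ⟶ Y`,
  `g : W ⟶ Z` of smooth projective varieties, from `CupPreservesHodgeType` of `W` ALONE; and
  `…_of_multiplicative_deRham`, from the multiplicative de Rham theorem alone.
* `isOfHodgeType_cupProduct_map_fst_map_snd_of_cupPreservesHodgeType`,
  `isOfHodgeType_cupProduct_map_fst_map_snd_of_multiplicative_deRham` — the same on a product
  `A₁.prod A₂` of complex abelian varieties with dimension parameters `a₁ + a₂` (abelian varieties
  are smooth projective of their dimension, `Motives.AbelianVariety.isSmoothProjective_holds`), in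
  the binder shape of the registered stub `stub_hodgeTypeExterior` of the summit lines
  `Cruxes/WeilTenfoldsSqrtMinus11/Lines/generic-ppav-secant-descent`,
  `Cruxes/WeilSixfoldsSqrtMinus7/Lines/hyperbolic-eightfold-descent` (Hodge conjecture summit):
  that stub is therefore `blocked-on: Literature.NumberTheory.Transcendental.exists_deRhamIsoFamily`
  and closes by `isOfHodgeType_cupProduct_map_fst_map_snd_of_multiplicative_deRham ‹_›`.

## References

* [VoisinHodgeI2002] C. Voisin, *Hodge Theory and Complex Algebraic Geometry I*, CUP 2002,
  §5.3.2 Thm. 5.29, §7.1.2, §7.3.2, §11.3.2 Thm. 11.38.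
* [WarnerGTM94] F. W. Warner, *Foundations of Differentiable Manifolds and Lie Groups*, GTM 94
  (1983), Thm. 5.36, Thm. 5.45.
* [SerreGAGA1956] J.-P. Serre, *Géométrie algébrique et géométrie analytique*, Ann. Inst.
  Fourier 6 (1956), §2 n°5 (fonctorialité de `X^h`).
-/

noncomputable section

open scoped Manifold ContDiff
open CategoryTheory
open Literature.AlgebraicTopology.SingularHomology

namespace Literature.AlgebraicGeometry.HodgeTheory

section HodgeTheory

/-! ### Pull-backs preserve Hodge types: the closed form -/

section Pullback

variable {m n : ℕ} {Y X : Motives.SchemeOver ℂ}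

/-- **Pull-backs preserve Hodge types** (Voisin I, §7.3.2: "`φ^*` is a morphism of Hodge
structures […] clearly the pullback of such a form is still of type `(p,q)`"; Serre, GAGA §2 n°5:
`f^an` is holomorphic), with no hypothesis left: for a `ℂ`-morphism `f : Y ⟶ X` of smooth
projective varieties and `c ∈ Hᵏ(X(ℂ); ℂ)` of Hodge type `(p, q)`, the class `f^* c` is of Hodge
type `(p, q)`. `IsOfHodgeType.map_of_independent` fed with the theorems
`hodgePQ_independent_of_hodgeModel_holds` and `nonempty_hodgeModel_holds` (a Hodge model of `Y`).
Relies on: nothing unproved. [cite: VoisinHodgeI2002, §7.3.2]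
[cite: SerreGAGA1956, §2 n°5 (fonctorialité de X^h)] -/
theorem IsOfHodgeType.map_of_isSmoothProjective {k p q : ℕ} {c : complexBetti X k}
    (hc : IsOfHodgeType n X k p q c) (hY : Motives.IsSmoothProjective m Y)
    (hX : Motives.IsSmoothProjective n X) (f : Y ⟶ X) :
    IsOfHodgeType m Y k p q (complexBetti.map f k c) :=
  hc.map_of_independent hodgePQ_independent_of_hodgeModel_holds hY hX
    (nonempty_hodgeModel_holds hY).some f

/-- **`PreservesHodgeType m n f` for every morphism `f : Y ⟶ X` of smooth projective complex
varieties** (the predicate of `GysinFormalismHodge`, carried as the hypothesis `hpull` / `hmap` by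
its consumers), with no hypothesis left. Relies on: nothing unproved.
[cite: VoisinHodgeI2002, §7.3.2] -/
theorem preservesHodgeType_of_isSmoothProjective (hY : Motives.IsSmoothProjective m Y)
    (hX : Motives.IsSmoothProjective n X) (f : Y ⟶ X) : PreservesHodgeType m n f :=
  fun _ _ _ _ hc ↦ hc.map_of_isSmoothProjective hY hX f

end Pullback

/-! ### The cup product adds Hodge types: one named fact away -/

section Cup

variable {n : ℕ} {X : Motives.SchemeOver ℂ}

/-- **`CupPreservesHodgeType n X` from the multiplicative de Rham theorem alone** (Voisin I,
§5.3.2 Thm. 5.29 with §7.1.2: the cup product of de Rham classes is the class of the wedge, and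
types add under `∧`). If for every finite-dimensional complex normed space `E` there is a natural,
multiplicative, normalised real de Rham isomorphism family over the manifolds charted on `E`
(`exists_deRhamIsoFamily 𝓘(ℝ, E)`; de Rham 1931, Warner Thms. 5.36 / 5.45), then on every smooth
projective `X/ℂ` of dimension `n` the cup product of a class of Hodge type `(p, q)` and a class of
Hodge type `(p', q')` is of Hodge type `(p + p', q + q')`.
`cupPreservesHodgeType_of_nonempty_hodgeModel` fed with the theorems
`hodgePQ_independent_of_hodgeModel_holds` and `nonempty_hodgeModel_holds`. Relies on: the
hypothesis `hdR` (an unproved named fact) only.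
[cite: VoisinHodgeI2002, §5.3.2 Thm. 5.29 and §7.1.2] [cite: WarnerGTM94, Thm. 5.36 / Thm. 5.45] -/
theorem cupPreservesHodgeType_of_multiplicative_deRham
    (hdR : ∀ (E : Type) [NormedAddCommGroup E] [NormedSpace ℂ E] [FiniteDimensional ℂ E],
      Literature.NumberTheory.Transcendental.exists_deRhamIsoFamily 𝓘(ℝ, E))
    (hX : Motives.IsSmoothProjective n X) : CupPreservesHodgeType n X :=
  cupPreservesHodgeType_of_nonempty_hodgeModel hodgePQ_independent_of_hodgeModel_holds
    nonempty_hodgeModel_holds hdR hX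

end Cup

/-! ### Hodge types of exterior products (Künneth compatibility of Hodge types) -/

section Exterior

variable {l m n : ℕ} {W Y Z : Motives.SchemeOver ℂ}

/-- **Hodge types add under exterior products** (Voisin I, §11.3.2 / Thm. 11.38: the Künneth
isomorphism is an isomorphism of Hodge structures and `⌣` is a morphism of Hodge structures): for
`ℂ`-morphisms `f : W ⟶ Y`, `g : W ⟶ Z` of smooth projective varieties, a class `c ∈ Hᵏ(Y(ℂ); ℂ)`
of type `(p, q)` and a class `w ∈ H^{k'}(Z(ℂ); ℂ)` of type `(p', q')`, the class
`f^* c ⌣ g^* w ∈ H^{k+k'}(W(ℂ); ℂ)` is of type `(p + p', q + q')` — GRANTED that the cup product of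
`W` adds Hodge types (`CupPreservesHodgeType l W`, the only input not yet a theorem); the
pull-back half is `IsOfHodgeType.map_of_isSmoothProjective`. Relies on: the hypothesis `hcup`
only.
[cite: VoisinHodgeI2002, §11.3.2 Thm. 11.38 and §7.3.2] -/
theorem isOfHodgeType_cupProduct_map_map_of_cupPreservesHodgeType
    (hW : Motives.IsSmoothProjective l W) (hY : Motives.IsSmoothProjective m Y)
    (hZ : Motives.IsSmoothProjective n Z) (f : W ⟶ Y) (g : W ⟶ Z) (hcup : CupPreservesHodgeType l W)
    {k k' s : ℕ} (hk : k + k' = s) {p q p' q' : ℕ} {c : complexBetti Y k} {w : complexBetti Z k'}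
    (hc : IsOfHodgeType m Y k p q c) (hw : IsOfHodgeType n Z k' p' q' w) :
    IsOfHodgeType l W s (p + p') (q + q')
      (cupProduct hk (complexBetti.map f k c) (complexBetti.map g k' w)) :=
  hcup hk (hc.map_of_isSmoothProjective hW hY f) (hw.map_of_isSmoothProjective hW hZ g)

/-- **Hodge types add under exterior products, from the multiplicative de Rham theorem alone**
(Voisin I, Thm. 11.38): as `isOfHodgeType_cupProduct_map_map_of_cupPreservesHodgeType`, the cup
product of `W` adding Hodge types by `cupPreservesHodgeType_of_multiplicative_deRham`. Relies on:
the hypothesis `hdR` (an unproved named fact) only. [cite: VoisinHodgeI2002, §11.3.2 Thm. 11.38]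
[cite: WarnerGTM94, Thm. 5.45] -/
theorem isOfHodgeType_cupProduct_map_map_of_multiplicative_deRham
    (hdR : ∀ (E : Type) [NormedAddCommGroup E] [NormedSpace ℂ E] [FiniteDimensional ℂ E],
      Literature.NumberTheory.Transcendental.exists_deRhamIsoFamily 𝓘(ℝ, E))
    (hW : Motives.IsSmoothProjective l W) (hY : Motives.IsSmoothProjective m Y)
    (hZ : Motives.IsSmoothProjective n Z) (f : W ⟶ Y) (g : W ⟶ Z)
    {k k' s : ℕ} (hk : k + k' = s) {p q p' q' : ℕ} {c : complexBetti Y k} {w : complexBetti Z k'}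
    (hc : IsOfHodgeType m Y k p q c) (hw : IsOfHodgeType n Z k' p' q' w) :
    IsOfHodgeType l W s (p + p') (q + q')
      (cupProduct hk (complexBetti.map f k c) (complexBetti.map g k' w)) :=
  isOfHodgeType_cupProduct_map_map_of_cupPreservesHodgeType hW hY hZ f g
    (cupPreservesHodgeType_of_multiplicative_deRham hdR hW) hk hc hw

end Exterior

/-! ### On a product of complex abelian varieties (the summit stub's binder shape) -/

section AbelianProduct

/-- **Hodge types of exterior products on `A₁ × A₂`, from `CupPreservesHodgeType` of the product
alone.** For complex abelian varieties `A₁`, `A₂` of dimensions `a₁`, `a₂` (smooth projective of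
their dimensions, `Motives.AbelianVariety.isSmoothProjective_holds`; the product is smooth
projective of dimension `a₁ + a₂`, `isSmoothProjective_prod`) and classes `c ∈ Hᵏ(A₁(ℂ); ℂ)` of
type `(p, q)`, `w ∈ Hˡ(A₂(ℂ); ℂ)` of type `(p', q')`, the exterior product `pr₁^* c ⌣ pr₂^* w` is
of type `(p + p', q + q')` on `A₁.prod A₂` with dimension parameter `a₁ + a₂`, granted
`CupPreservesHodgeType (a₁ + a₂) (A₁.prod A₂).X` (the tree's
`isOfHodgeType_cupProduct_map_fst_map_snd` with its two `PreservesHodgeType` hypotheses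
discharged by `preservesHodgeType_of_isSmoothProjective`). Relies on: the hypothesis `hcup`
only.
[cite: VoisinHodgeI2002, §11.3.2 Thm. 11.38 and §7.3.2] -/
theorem isOfHodgeType_cupProduct_map_fst_map_snd_of_cupPreservesHodgeType
    (A₁ A₂ : Motives.AbelianVariety ℂ) {a₁ a₂ : ℕ} (h₁ : A₁.dim = a₁) (h₂ : A₂.dim = a₂)
    (hcup : CupPreservesHodgeType (a₁ + a₂) (A₁.prod A₂).X) {k l m : ℕ} (hklm : k + l = m)
    {p q p' q' : ℕ} {c : complexBetti A₁.X k} {w : complexBetti A₂.X l}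
    (hc : IsOfHodgeType a₁ A₁.X k p q c) (hw : IsOfHodgeType a₂ A₂.X l p' q' w) :
    IsOfHodgeType (a₁ + a₂) (A₁.prod A₂).X m (p + p') (q + q')
      (cupProduct hklm (complexBetti.map (Motives.AbelianVariety.fst A₁ A₂).hom.hom.hom k c)
        (complexBetti.map (Motives.AbelianVariety.snd A₁ A₂).hom.hom.hom l w)) := by
  subst h₁ h₂
  have hA₁ : Motives.IsSmoothProjective A₁.dim A₁.X :=
    Motives.AbelianVariety.isSmoothProjective_holds
  have hA₂ : Motives.IsSmoothProjective A₂.dim A₂.X :=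
    Motives.AbelianVariety.isSmoothProjective_holds
  exact isOfHodgeType_cupProduct_map_fst_map_snd hklm
    (preservesHodgeType_of_isSmoothProjective (isSmoothProjective_prod hA₁ hA₂) hA₁ _)
    (preservesHodgeType_of_isSmoothProjective (isSmoothProjective_prod hA₁ hA₂) hA₂ _) hcup hc hw

/-- **Hodge types of exterior products on products of complex abelian varieties, from the
multiplicative de Rham theorem alone** (Voisin I, Thm. 11.38), literally
`hdR → (the statement of the summit stub stub_hodgeTypeExterior)`: for complex abelian varieties
`A`, `B` of dimensions `a`, `b` and classes `c ∈ Hᵏ(A(ℂ); ℂ)` of type `(p, q)`,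
`w ∈ Hˡ(B(ℂ); ℂ)` of type `(p', q')`, the exterior product `pr_A^* c ⌣ pr_B^* w` is of type
`(p + p', q + q')` on `A.prod B` with dimension parameter `a + b`. The cup-product input is
`cupPreservesHodgeType_of_multiplicative_deRham` on the product (smooth projective of dimension
`a + b`). Relies on: the hypothesis `hdR` (an unproved named fact) only.
[cite: VoisinHodgeI2002, §11.3.2 Thm. 11.38] [cite: WarnerGTM94, Thm. 5.45] -/
theorem isOfHodgeType_cupProduct_map_fst_map_snd_of_multiplicative_deRham
    (hdR : ∀ (E : Type) [NormedAddCommGroup E] [NormedSpace ℂ E] [FiniteDimensional ℂ E],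
      Literature.NumberTheory.Transcendental.exists_deRhamIsoFamily 𝓘(ℝ, E)) :
    ∀ (A B : Motives.AbelianVariety ℂ) (a b : ℕ), A.dim = a → B.dim = b →
    ∀ (k l m : ℕ) (hklm : k + l = m) (p q p' q' : ℕ)
      (c : complexBetti A.X k) (w : complexBetti B.X l),
      IsOfHodgeType a A.X k p q c → IsOfHodgeType b B.X l p' q' w →
      IsOfHodgeType (a + b) (A.prod B).X m (p + p') (q + q')
        (cupProduct hklm (complexBetti.map (Motives.AbelianVariety.fst A B).hom.hom.hom k c)
          (complexBetti.map (Motives.AbelianVariety.snd A B).hom.hom.hom l w)) := by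
  intro A B a b ha hb k l m hklm p q p' q' c w hc hw
  refine isOfHodgeType_cupProduct_map_fst_map_snd_of_cupPreservesHodgeType A B ha hb
    (cupPreservesHodgeType_of_multiplicative_deRham hdR ?_) hklm hc hw
  subst ha hb
  exact isSmoothProjective_prod Motives.AbelianVariety.isSmoothProjective_holds
    Motives.AbelianVariety.isSmoothProjective_holds

end AbelianProduct

end HodgeTheory

end Literature.AlgebraicGeometry.HodgeTheory

end
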